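import Literature.AlgebraicGeometry.Resolution.ExcellentRings
import Literature.AlgebraicGeometry.Resolution.RegularLocalRingsJacobian
import Mathlib.RingTheory.RegularLocalRing.Polynomial
import Mathlib.RingTheory.LocalRing.ResidueField.Fiber
import Mathlib.RingTheory.AdjoinRoot
import Mathlib.FieldTheory.KummerPolynomial
import Mathlib.Algebra.CharP.Algebra
import HarnessLib

/-!
# Crux `Steer` (stmt-ResolutionOfSingularities-16345), chain W4.1 — K-β7-hat W1 `BranchTransfer`, FILE 1: squares seen by a geometrically regular fibre

OURS (campaign `res-hironaka`, rung L ★L-G4, slot W4.1; res-L0-w41-idea-3 g12, object of record W1 by res-L0-w41-plan-1 RULINGS 237(b)/242(c);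
plan `L/res-L0-w41-idea-3/k7w1/W1-PLAN.md`). Def-free kernel piece №1 of the proof of the tree word
`…Theorems.SwitchingDichotomy.K7Hat.BranchTransfer` (p555432): the FIBRE LEMMA that drives both the height count of the centre `Q₀ = P₁ ∩ S`
(step (G1): the residue of the radicand `F` in `κ(Q₀)` is a square) and, at fibre dimension `0`, the square-closedness hypothesis of the treeʼs
`SquareDescent` (step (iv)). Replaces the role of no printed item; NOT a statement of the manuscript under review [claim: Hironaka2017, status:
under-review]; AI-produced, weaker than expert review; counted 0.

THE LEMMA (`sq_of_isGeometricallyRegular`). `k` a field of characteristic `2`, `Φ` a GEOMETRICALLY REGULAR `k`-algebra (tree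
`IsGeometricallyRegular`: `k′ ⊗_k Φ` is a regular ring for every finite field extension `k′/k`), `P` a prime of `Φ`, `a ∈ k` and `β ∈ Φ_P` with
`a + β² ∈ (PΦ_P)²`. THEN `a` is a square in `k`. PROOF. If not, `k′ := k[Y]/(Y² − a)` is a field, finite over `k`, so `k′ ⊗_k Φ ≅ Φ[X]/(G)`,
`G := X² − a`, is a regular ring (Mathlib `AdjoinRoot.tensorAlgEquiv`). Write `β = β₀/s` and let `𝔔 ⊂ Φ[X]` be the kernel of
`Φ[X] → Φ_P → Φ_P/PΦ_P`, `X ↦ β`; it contains `G` (characteristic `2`: `β² − a = a + β²`) and `h := sX − β₀`, and contracts to `P`. In the regular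
local ring `T := Φ[X]_𝔔` one has `s²·G = h² + (β₀² − s²a)` with `h ∈ 𝔔` and `β₀² − s²a ↦ s²(a + β²) ∈ (PΦ_P)²`, so `G ∈ 𝔪_T²` (`s` is a unit), and
`G ≠ 0` in `T` (`G` is monic); hence `T/(G)` is NOT regular (tree `not_isRegularLocalRing_quotient_span_singleton_of_mem_sq`, Matsumura 14.2), while
`(Φ[X]/(G))_𝔑 ≅ T/(G)` IS regular (tree `isRegularLocalRing_localization_quotient_span_singleton`) — contradiction. Geometric (not plain) regularity is
load-bearing: `A = 𝔽₂(a)[y]_(y) → B = A[t]/(t² − a)` has regular fibres, `F = a`, `q = t`, and `a ∉ k²`.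

COROLLARY A (`residue_eq_sq_of_fiber`, = step (G1) of W1). `A → B` with geometrically regular fibre `κ(𝔭) ⊗_A B` over a prime `𝔭` (e.g. a
G-ring and its completion, tree `IsGRing.isRegularHom_adicCompletion`), `𝔔` a prime of `B` over `𝔭`, `F ∈ A`, `q ∈ B`, `F + q² ∈ 𝔔²`: the residue of
`F` in `κ(𝔭)` is a square (the lemma at the prime of the fibre ring under `𝔔`, Mathlib `PrimeSpectrum.primesOverOrderIsoFiber`).
[cite: Matsumura1987, Thm. 14.2, §32 p. 256] [folklore]
bears_on: LADDER-RESOLUTION L ★L-G4 W4.1 (crux `Steer`, β-leaf binder hβ6′ `FormalCentreDescent`, crux piece W1 `BranchTransfer`).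
-/

noncomputable section

set_option linter.dupNamespace false
set_option autoImplicit false

open IsLocalRing Polynomial TensorProduct

namespace Summit.ResolutionOfSingularities.ResolutionOfSingularities.Theorems.SwitchingDichotomy.K7HatFibreSquares

open Literature.AlgebraicGeometry.Resolution

universe u

/-! ## Small algebra -/

section CharTwo

variable {R : Type u} [CommRing R]

/-- In characteristic `2`: `s² (X² − a) = (sX − b)² + (b² − s² a)`. -/
theorem C_sq_mul_X_sq_sub_C (h2 : (2 : R) = 0) (s b a : R) :
    C (s ^ 2) * (X ^ 2 - C a) = (C s * X - C b) ^ 2 + C (b ^ 2 - s ^ 2 * a) := by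
  have h2' : (2 : R[X]) = 0 := by rw [show (2 : R[X]) = C (2 : R) from (map_ofNat C 2).symm, h2, map_zero]
  simp only [map_pow, map_sub, map_mul]
  linear_combination (C s * C b * X - C b ^ 2) * h2'

/-- In characteristic `2`: `b² − s² a = s² (a + β²)` whenever `s β = b`. -/
theorem sq_sub_sq_mul_eq (h2 : (2 : R) = 0) {s b a β : R} (h : s * β = b) :
    b ^ 2 - s ^ 2 * a = s ^ 2 * (a + β ^ 2) := by
  have hneg : ∀ x : R, -x = x := fun x => by
    have : (2 : R) * x = 0 := by rw [h2, zero_mul]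
    linear_combination -this
  rw [← h, sub_eq_add_neg, hneg]
  ring

end CharTwo

/-! ## The fibre lemma -/

section Fibre

variable {k Φ : Type u} [Field k] [CharP k 2] [CommRing Φ] [Algebra k Φ]

omit [CharP k 2] in
/-- `k′ ⊗_k Φ ≅ Φ[X]/(f ⊗ 1)` for `k′ = k[Y]/(f)`: Mathlib's `AdjoinRoot.tensorAlgEquiv` followed by `Φ ⊗_k k ≅ Φ` (stated as `Nonempty`, to
keep this file definition-free). [folklore] -/
theorem nonempty_tensorAdjoinRootEquiv (f : k[X]) :
    Nonempty (AdjoinRoot f ⊗[k] Φ ≃+* AdjoinRoot (f.map (algebraMap k Φ))) := by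
  let ι : k →+* Φ ⊗[k] k :=
    (Algebra.TensorProduct.includeRight (R := k) (A := Φ) (B := k)).toRingHom
  let ρ : Φ ⊗[k] k ≃+* Φ := (Algebra.TensorProduct.rid k Φ Φ).toRingEquiv
  have hρι : (ρ : Φ ⊗[k] k →+* Φ).comp ι = algebraMap k Φ := by
    refine RingHom.ext fun x => ?_
    change Algebra.TensorProduct.rid k Φ Φ ((1 : Φ) ⊗ₜ[k] x) = algebraMap k Φ x
    rw [Algebra.TensorProduct.rid_tmul, Algebra.algebraMap_eq_smul_one]
  have hmap : (f.map ι).map (ρ : Φ ⊗[k] k →+* Φ) = f.map (algebraMap k Φ) := by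
    rw [Polynomial.map_map, hρι]
  exact ⟨(Algebra.TensorProduct.comm k (AdjoinRoot f) Φ).toRingEquiv.trans <|
    (AdjoinRoot.tensorAlgEquiv (R := k) (S := k) (T := Φ) f (f.map ι) rfl).toRingEquiv.trans <|
      AdjoinRoot.mapRingEquiv ρ (f.map ι) (f.map (algebraMap k Φ)) (hmap ▸ Associated.refl _)⟩

/-- **Fibre lemma.** `k` a field of characteristic `2`, `Φ` a geometrically regular `k`-algebra, `P` a prime of `Φ`, `a ∈ k`, `β ∈ Φ_P`
with `a + β² ∈ (PΦ_P)²`: then `a` is a square in `k`. [cite: Matsumura1987, Thm. 14.2] [folklore] -/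
theorem sq_of_isGeometricallyRegular (hgeo : IsGeometricallyRegular k Φ) (P : Ideal Φ) [P.IsPrime] (a : k)
    (β : Localization.AtPrime P)
    (H : algebraMap k (Localization.AtPrime P) a + β ^ 2 ∈ maximalIdeal (Localization.AtPrime P) ^ 2) :
    ∃ c : k, a = c ^ 2 := by
  classical
  by_contra hne
  have hne' : ∀ c : k, c ^ 2 ≠ a := fun c hc => hne ⟨c, hc.symm⟩
  -- ### `k′ = k(√a)` is a field, finite over `k`
  set f : k[X] := X ^ 2 - C a with hf
  have hirr : Irreducible f := X_pow_sub_C_irreducible_of_prime Nat.prime_two hne'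
  haveI : Fact (Irreducible f) := ⟨hirr⟩
  haveI : Module.Finite k (AdjoinRoot f) := (monic_X_pow_sub_C a two_ne_zero).finite_adjoinRoot
  -- ### regularity: `Φ` and `Φ[X]/(G)` are regular rings
  haveI hΦreg : IsRegularRing Φ := by
    haveI : IsRegularRing (k ⊗[k] Φ) := hgeo k inferInstance
    exact IsRegularRing.of_ringEquiv (R := k ⊗[k] Φ) (Algebra.TensorProduct.lid k Φ).toRingEquiv
  set G : Φ[X] := X ^ 2 - C (algebraMap k Φ a) with hG
  have hfG : f.map (algebraMap k Φ) = G := by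
    rw [hf, hG, Polynomial.map_sub, Polynomial.map_pow, Polynomial.map_X, Polynomial.map_C]
  haveI hGreg : IsRegularRing (AdjoinRoot G) := by
    haveI : IsRegularRing (AdjoinRoot f ⊗[k] Φ) := hgeo (AdjoinRoot f) inferInstance
    rw [← hfG]
    obtain ⟨e⟩ := nonempty_tensorAdjoinRootEquiv (Φ := Φ) f
    exact IsRegularRing.of_ringEquiv (R := AdjoinRoot f ⊗[k] Φ) e
  have hGmon : G.Monic := monic_X_pow_sub_C _ two_ne_zero
  -- ### characteristic `2` bookkeeping
  haveI : Nontrivial Φ := by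
    rcases subsingleton_or_nontrivial Φ with h | h
    · exact absurd (Subsingleton.elim _ _) (Ideal.IsPrime.ne_top (I := P) inferInstance)
    · exact h
  haveI : FaithfulSMul k Φ := (faithfulSMul_iff_algebraMap_injective k Φ).mpr (algebraMap k Φ).injective
  haveI : FaithfulSMul k (Localization.AtPrime P) := (faithfulSMul_iff_algebraMap_injective k (Localization.AtPrime P)).mpr (algebraMap k (Localization.AtPrime P)).injective
  haveI : CharP Φ 2 := charP_of_injective_algebraMap' k 2
  haveI : CharP (Localization.AtPrime P) 2 := charP_of_injective_algebraMap' k 2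
  have h2Φ : (2 : Φ) = 0 := by simpa using CharP.cast_eq_zero Φ 2
  have h2L : (2 : (Localization.AtPrime P)) = 0 := by simpa using CharP.cast_eq_zero (Localization.AtPrime P) 2
  -- ### `β = β₀ / s`
  obtain ⟨⟨β₀, s⟩, hβ0⟩ := IsLocalization.mk'_surjective P.primeCompl β
  have hβ : IsLocalization.mk' (Localization.AtPrime P) β₀ s = β := hβ0
  have hsβ : algebraMap Φ (Localization.AtPrime P) s * β = algebraMap Φ (Localization.AtPrime P) β₀ := by
    rw [← hβ]; exact IsLocalization.mk'_spec' (Localization.AtPrime P) β₀ s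
  -- ### the prime `𝔔 ⊂ Φ[X]`: kernel of `X ↦ β` into `Φ_P / PΦ_P`
  let ev : Φ[X] →+* (Localization.AtPrime P) := Polynomial.eval₂RingHom (algebraMap Φ (Localization.AtPrime P)) β
  have hevC : ∀ x : Φ, ev (C x) = algebraMap Φ (Localization.AtPrime P) x := fun x => Polynomial.eval₂_C _ _
  have hevX : ev X = β := Polynomial.eval₂_X _ _
  set 𝔔 : Ideal Φ[X] := (maximalIdeal (Localization.AtPrime P)).comap ev with h𝔔
  haveI h𝔔p : 𝔔.IsPrime := Ideal.comap_isPrime ev _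
  have h𝔔C : 𝔔.comap (C : Φ →+* Φ[X]) = P := by
    ext x
    rw [Ideal.mem_comap, h𝔔, Ideal.mem_comap, hevC]
    exact IsLocalization.AtPrime.to_map_mem_maximal_iff (Localization.AtPrime P) P x
  have hG𝔔 : G ∈ 𝔔 := by
    rw [h𝔔, Ideal.mem_comap, hG, map_sub, map_pow, hevX, hevC, ← IsScalarTower.algebraMap_apply]
    have : β ^ 2 - algebraMap k (Localization.AtPrime P) a = algebraMap k (Localization.AtPrime P) a + β ^ 2 := by
      have hneg : -(algebraMap k (Localization.AtPrime P) a) = algebraMap k (Localization.AtPrime P) a := by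
        have : (2 : (Localization.AtPrime P)) * algebraMap k (Localization.AtPrime P) a = 0 := by rw [h2L, zero_mul]
        linear_combination -this
      rw [sub_eq_add_neg, hneg, add_comm]
    rw [this]
    exact Ideal.pow_le_self two_ne_zero H
  have hh𝔔 : C (s : Φ) * X - C β₀ ∈ 𝔔 := by
    rw [h𝔔, Ideal.mem_comap, map_sub, map_mul, hevC, hevC, hevX, hsβ, sub_self]
    exact Ideal.zero_mem _
  have hCs : C (s : Φ) ∉ 𝔔 := by
    rw [h𝔔, Ideal.mem_comap, hevC]
    exact fun h => s.2 ((IsLocalization.AtPrime.to_map_mem_maximal_iff (Localization.AtPrime P) P _).mp h)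
  -- ### the prime `𝔑 = 𝔔/(G)` of `Φ[X]/(G)` and its preimage
  let π : Φ[X] →+* Φ[X] ⧸ Ideal.span {G} := Ideal.Quotient.mk (Ideal.span {G})
  have hker : RingHom.ker π ≤ 𝔔 := by
    rw [Ideal.mk_ker, Ideal.span_singleton_le_iff_mem]
    exact hG𝔔
  let 𝔑 : Ideal (Φ[X] ⧸ Ideal.span {G}) := 𝔔.map π
  haveI h𝔑 : 𝔑.IsPrime := Ideal.map_isPrime_of_surjective Ideal.Quotient.mk_surjective hker
  set Q : Ideal Φ[X] := 𝔑.comap (Ideal.Quotient.mk (Ideal.span {G})) with hQdef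
  have hQ𝔔 : Q = 𝔔 := by
    rw [hQdef]
    change (𝔔.map π).comap π = 𝔔
    rw [Ideal.comap_map_of_surjective _ Ideal.Quotient.mk_surjective, ← RingHom.ker_eq_comap_bot]
    exact sup_eq_left.mpr hker
  haveI hQp : Q.IsPrime := Ideal.comap_isPrime _ 𝔑
  -- ### the regular local ring `T = Φ[X]_𝔔` and `G ∈ 𝔪_T²`, `G ≠ 0`
  set T := Localization.AtPrime Q with hT
  haveI : IsRegularLocalRing T := IsRegularRing.isRegularLocalRing_localization Q
  have hPQ : P = Q.comap (C : Φ →+* Φ[X]) := by rw [hQ𝔔, h𝔔C]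
  let ψ : (Localization.AtPrime P) →+* T := Localization.localRingHom P Q (C : Φ →+* Φ[X]) hPQ
  have hψ : ∀ x : Φ, ψ (algebraMap Φ (Localization.AtPrime P) x) = algebraMap Φ[X] T (C x) := fun x =>
    Localization.localRingHom_to_map P Q _ hPQ x
  have hψm : ∀ y ∈ maximalIdeal (Localization.AtPrime P) ^ 2, ψ y ∈ maximalIdeal T ^ 2 := by
    intro y hy
    have hle : (maximalIdeal (Localization.AtPrime P)).map ψ ≤ maximalIdeal T :=
      Ideal.map_le_iff_le_comap.mpr fun x hx => map_nonunit ψ x hx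
    have := Ideal.mem_map_of_mem ψ hy
    rw [Ideal.map_pow] at this
    exact Ideal.pow_right_mono hle 2 this
  have hGT2 : algebraMap Φ[X] T G ∈ maximalIdeal T ^ 2 := by
    -- `s² G = h² + (β₀² − s² a)` with both summands in `𝔪_T²`, and `s` a unit of `T`
    have hid := C_sq_mul_X_sq_sub_C h2Φ (s : Φ) β₀ (algebraMap k Φ a)
    rw [← hG] at hid
    have h1 : algebraMap Φ[X] T ((C (s : Φ) * X - C β₀) ^ 2) ∈ maximalIdeal T ^ 2 := by
      rw [map_pow]
      refine Ideal.pow_mem_pow ?_ 2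
      rw [← Localization.AtPrime.map_eq_maximalIdeal]
      exact Ideal.mem_map_of_mem _ (hQ𝔔 ▸ hh𝔔)
    have h2 : algebraMap Φ[X] T (C (β₀ ^ 2 - (s : Φ) ^ 2 * algebraMap k Φ a)) ∈ maximalIdeal T ^ 2 := by
      rw [← hψ]
      refine hψm _ ?_
      rw [map_sub, map_mul, map_pow, map_pow, ← IsScalarTower.algebraMap_apply,
        sq_sub_sq_mul_eq h2L hsβ]
      exact Ideal.mul_mem_left _ _ H
    have hsum : algebraMap Φ[X] T (C ((s : Φ) ^ 2)) * algebraMap Φ[X] T G ∈ maximalIdeal T ^ 2 := by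
      rw [← map_mul, hid, map_add]
      exact Ideal.add_mem _ h1 h2
    have hunit : IsUnit (algebraMap Φ[X] T (C ((s : Φ) ^ 2))) := by
      apply IsLocalization.map_units T (⟨C ((s : Φ) ^ 2), ?_⟩ : Q.primeCompl)
      rw [map_pow]
      show C (s : Φ) ^ 2 ∉ Q
      rw [hQ𝔔]
      exact fun h => hCs (Ideal.IsPrime.mem_of_pow_mem inferInstance 2 h)
    obtain ⟨u, hu⟩ := hunit
    rw [← hu] at hsum
    have := Ideal.mul_mem_left _ (↑u⁻¹ : T) hsum
    rwa [← mul_assoc, Units.inv_mul, one_mul] at this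
  have hGT0 : algebraMap Φ[X] T G ≠ 0 := by
    intro h0
    obtain ⟨m, hm⟩ := (IsLocalization.map_eq_zero_iff Q.primeCompl T G).mp h0
    have hm0 : (m : Φ[X]) = 0 := hGmon.mul_left_eq_zero_iff.mp hm
    exact m.2 (hm0 ▸ Q.zero_mem)
  -- ### contradiction: `(Φ[X]/(G))_𝔑 ≅ T/(G)` is regular and is not
  have hregN : IsRegularLocalRing (Localization.AtPrime (𝔑 : Ideal (Φ[X] ⧸ Ideal.span {G}))) :=
    @IsRegularRing.isRegularLocalRing_localization (AdjoinRoot G) _ hGreg 𝔑 h𝔑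
  have hreg := @isRegularLocalRing_localization_quotient_span_singleton Φ[X] _ G 𝔑 h𝔑 hregN
  exact not_isRegularLocalRing_quotient_span_singleton_of_mem_sq hGT0 hGT2 hreg

end Fibre

/-! ## Corollary A: residue squares along a homomorphism with geometrically regular fibre -/

section ResidueSquare

variable {A B : Type u} [CommRing A] [CommRing B] [Algebra A B]

/-- Characteristic `2` passes to any nontrivial algebra. -/
theorem charP_two_of_algebra [CharP A 2] (C' : Type u) [CommRing C'] [Algebra A C'] [Nontrivial C'] :
    CharP C' 2 := by
  refine CharTwo.of_one_ne_zero_of_two_eq_zero one_ne_zero ?_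
  have h : (2 : C') = algebraMap A C' 2 := by rw [map_ofNat]
  rw [h, show (2 : A) = 0 by simpa using CharP.cast_eq_zero A 2, map_zero]

/-- **Corollary A (step (G1) of W1).** `A → B` with geometrically regular fibre over the prime `𝔭`, `𝔔` a prime of `B` over `𝔭`, `F ∈ A`,
`q ∈ B` with `F + q² ∈ 𝔔²`: the residue of `F` in `κ(𝔭)` is a square. [cite: Matsumura1987, Thm. 14.2, §32 p. 256] [folklore] -/
theorem residue_eq_sq_of_fiber [CharP A 2] (p : Ideal A) [p.IsPrime]
    (hgeo : IsGeometricallyRegular p.ResidueField (p.Fiber B))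
    (P : Ideal B) [P.IsPrime] [P.LiesOver p] (F : A) (q : B) (h : algebraMap A B F + q ^ 2 ∈ P ^ 2) :
    ∃ c : p.ResidueField, algebraMap A p.ResidueField F = c ^ 2 := by
  classical
  haveI : CharP p.ResidueField 2 := charP_two_of_algebra (A := A) p.ResidueField
  -- the prime of the fibre ring under `𝔔`
  let qf : PrimeSpectrum (p.Fiber B) :=
    PrimeSpectrum.primesOverOrderIsoFiber A B p ⟨P, inferInstance, inferInstance⟩
  have hq : qf.asIdeal.comap (Algebra.TensorProduct.includeRight : B →ₐ[A] p.Fiber B) = P := by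
    have h1 := PrimeSpectrum.coe_primesOverOrderIsoFiber_symm_apply (R := A) (S := B) p qf
    rw [OrderIso.symm_apply_apply] at h1
    exact h1.symm
  -- `F + q² ∈ 𝔔²` read in the fibre ring and then in its local ring at `qf`
  set Lq := Localization.AtPrime qf.asIdeal with hLq
  let ιB : B →ₐ[A] p.Fiber B := Algebra.TensorProduct.includeRight
  have hmem : ιB (algebraMap A B F + q ^ 2) ∈ qf.asIdeal ^ 2 := by
    have h' : algebraMap A B F + q ^ 2 ∈ (qf.asIdeal.comap ιB) ^ 2 := by rw [hq]; exact h
    have h2 := Ideal.mem_map_of_mem ιB h'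
    rw [Ideal.map_pow] at h2
    exact Ideal.pow_right_mono Ideal.map_comap_le 2 h2
  have hιF : ιB (algebraMap A B F) = algebraMap p.ResidueField (p.Fiber B) (algebraMap A p.ResidueField F) := by
    rw [AlgHom.commutes, IsScalarTower.algebraMap_apply A p.ResidueField (p.Fiber B)]
  refine sq_of_isGeometricallyRegular hgeo qf.asIdeal (algebraMap A p.ResidueField F)
    (algebraMap (p.Fiber B) Lq (ιB q)) ?_
  rw [IsScalarTower.algebraMap_apply p.ResidueField (p.Fiber B) Lq, ← hιF, ← map_pow, ← map_add,
    ← map_pow, ← map_add, ← Localization.AtPrime.map_eq_maximalIdeal, ← Ideal.map_pow]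
  exact Ideal.mem_map_of_mem _ hmem

end ResidueSquare

/-! ## Corollary B: square-closedness of `A_𝔭 → B_𝔔` modulo `(𝔔B_𝔔)² + 𝔭B_𝔔` -/

section SquareClosed

variable {A B : Type u} [CommRing A] [CommRing B] [Algebra A B]

/-- **Corollary B (hypothesis `h2` of the treeʼs `SquareDescent` at fibre dimension `0`).** `A → B` with geometrically regular fibre over `𝔭`,
`𝔔` a prime of `B` over `𝔭`, `A_𝔭 → B_𝔔` the induced local homomorphism; `b ∈ B_𝔔`, `a ∈ A_𝔭` with `b² − a ∈ (𝔔B_𝔔)² + 𝔭B_𝔔`. Then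
`b ≡ a′ (mod 𝔔B_𝔔)` for some `a′ ∈ A_𝔭`: the residue of `a` is a square `c̄²` in `κ(𝔭)` by the fibre lemma (along `B_𝔔 → (κ(𝔭) ⊗_A B)_𝔮`,
which kills `𝔭`), and `a′ := c` works since `(b − c)² ≡ (b² − a) + (a − c²) (mod 2)`. [cite: Matsumura1987, Thm. 14.2, §32 p. 256] [folklore] -/
theorem sub_mem_of_sq_sub_mem [CharP A 2] (p : Ideal A) [p.IsPrime]
    (hgeo : IsGeometricallyRegular p.ResidueField (p.Fiber B))
    (P : Ideal B) [P.IsPrime] [P.LiesOver p]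
    [Algebra (Localization.AtPrime p) (Localization.AtPrime P)] [Localization.AtPrime.IsLiesOverAlgebra p P]
    (b : Localization.AtPrime P) (a : Localization.AtPrime p)
    (h : b ^ 2 - algebraMap (Localization.AtPrime p) (Localization.AtPrime P) a ∈
      maximalIdeal (Localization.AtPrime P) ^ 2 ⊔ p.map (algebraMap A (Localization.AtPrime P))) :
    ∃ a' : Localization.AtPrime p,
      b - algebraMap (Localization.AtPrime p) (Localization.AtPrime P) a' ∈ maximalIdeal (Localization.AtPrime P) := by
  classical
  haveI : CharP p.ResidueField 2 := charP_two_of_algebra (A := A) p.ResidueField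
  haveI : CharP (Localization.AtPrime P) 2 := charP_two_of_algebra (A := A) (Localization.AtPrime P)
  have h2B : (2 : Localization.AtPrime P) = 0 := by simpa using CharP.cast_eq_zero (Localization.AtPrime P) 2
  -- the structure map `φ : A_𝔭 → B_𝔔` is local
  haveI hφloc : IsLocalHom (algebraMap (Localization.AtPrime p) (Localization.AtPrime P)) := by
    rw [Localization.AtPrime.IsLiesOverAlgebra.algebraMap_eq (p := p) (P := P)]
    infer_instance
  -- the prime of the fibre ring under `𝔔` and the local map `ψ : B_𝔔 → Φ_𝔮`
  let qf : PrimeSpectrum (p.Fiber B) :=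
    PrimeSpectrum.primesOverOrderIsoFiber A B p ⟨P, inferInstance, inferInstance⟩
  let ιB : B →ₐ[A] p.Fiber B := Algebra.TensorProduct.includeRight
  have hq : qf.asIdeal.comap ιB = P := by
    have h1 := PrimeSpectrum.coe_primesOverOrderIsoFiber_symm_apply (R := A) (S := B) p qf
    rw [OrderIso.symm_apply_apply] at h1
    exact h1.symm
  have hq' : P = qf.asIdeal.comap (ιB : B →+* p.Fiber B) := by rw [Ideal.comap_coe]; exact hq.symm
  let ψ : Localization.AtPrime P →+* Localization.AtPrime qf.asIdeal :=
    Localization.localRingHom P qf.asIdeal (ιB : B →+* p.Fiber B) hq'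
  have hψB : ∀ y : B, ψ (algebraMap B (Localization.AtPrime P) y) =
      algebraMap (p.Fiber B) (Localization.AtPrime qf.asIdeal) (ιB y) := fun y =>
    Localization.localRingHom_to_map P qf.asIdeal _ hq' y
  have hιF : ∀ x : A, ιB (algebraMap A B x) =
      algebraMap p.ResidueField (p.Fiber B) (algebraMap A p.ResidueField x) := fun x => by
    rw [AlgHom.commutes, IsScalarTower.algebraMap_apply A p.ResidueField (p.Fiber B)]
  -- `ψ` kills `𝔭` and maps `𝔪²` into `𝔪²`
  have hψp : p.map (algebraMap A (Localization.AtPrime P)) ≤ RingHom.ker ψ := by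
    refine Ideal.map_le_iff_le_comap.mpr fun π hπ => ?_
    rw [Ideal.mem_comap, RingHom.mem_ker, IsScalarTower.algebraMap_apply A B (Localization.AtPrime P), hψB,
      hιF, Ideal.algebraMap_residueField_eq_zero.mpr hπ, map_zero, map_zero]
  have hψm : ∀ y ∈ maximalIdeal (Localization.AtPrime P) ^ 2,
      ψ y ∈ maximalIdeal (Localization.AtPrime qf.asIdeal) ^ 2 := by
    intro y hy
    have hle : (maximalIdeal (Localization.AtPrime P)).map ψ ≤ maximalIdeal (Localization.AtPrime qf.asIdeal) :=
      Ideal.map_le_iff_le_comap.mpr fun x hx => map_nonunit ψ x hx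
    have := Ideal.mem_map_of_mem ψ hy
    rw [Ideal.map_pow] at this
    exact Ideal.pow_right_mono hle 2 this
  -- `ψ ∘ φ = (κ(𝔭) → Φ_𝔮) ∘ residue` on `A_𝔭`
  have hψφ : ψ.comp (algebraMap (Localization.AtPrime p) (Localization.AtPrime P)) =
      (algebraMap p.ResidueField (Localization.AtPrime qf.asIdeal)).comp
        (IsLocalRing.residue (Localization.AtPrime p)) := by
    refine IsLocalization.ringHom_ext p.primeCompl (RingHom.ext fun x => ?_)
    rw [RingHom.comp_apply, RingHom.comp_apply, RingHom.comp_apply, RingHom.comp_apply,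
      ← IsScalarTower.algebraMap_apply A (Localization.AtPrime p) (Localization.AtPrime P),
      IsScalarTower.algebraMap_apply A B (Localization.AtPrime P), hψB, hιF,
      IsScalarTower.algebraMap_apply p.ResidueField (p.Fiber B) (Localization.AtPrime qf.asIdeal),
      ← IsLocalRing.ResidueField.algebraMap_eq, ← IsScalarTower.algebraMap_apply A (Localization.AtPrime p) p.ResidueField]
  have hψa : ∀ x : Localization.AtPrime p, ψ (algebraMap _ (Localization.AtPrime P) x) =
      algebraMap p.ResidueField (Localization.AtPrime qf.asIdeal) (IsLocalRing.residue _ x) := fun x => by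
    have := congrArg (fun f => f x) hψφ
    simpa only [RingHom.comp_apply] using this
  -- the fibre lemma: the residue of `a` is a square `c̄²`
  obtain ⟨y, hy, z, hz, hyz⟩ := Submodule.mem_sup.mp h
  have hψz : ψ z = 0 := RingHom.mem_ker.mp (hψp hz)
  have H : algebraMap p.ResidueField (Localization.AtPrime qf.asIdeal) (IsLocalRing.residue _ a) + (ψ b) ^ 2 ∈
      maximalIdeal (Localization.AtPrime qf.asIdeal) ^ 2 := by
    have hba : algebraMap _ (Localization.AtPrime P) a + b ^ 2 = y + z := by
      rw [hyz]
      have : (2 : Localization.AtPrime P) * algebraMap _ (Localization.AtPrime P) a = 0 := by rw [h2B, zero_mul]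
      linear_combination this
    rw [← hψa, ← map_pow, ← map_add, hba, map_add, hψz, add_zero]
    exact hψm y hy
  obtain ⟨cbar, hcbar⟩ := sq_of_isGeometricallyRegular hgeo qf.asIdeal _ (ψ b) H
  obtain ⟨c, hc⟩ : ∃ c : Localization.AtPrime p, IsLocalRing.residue _ c = cbar := Ideal.Quotient.mk_surjective cbar
  -- `a′ := c`
  refine ⟨c, ?_⟩
  have hac : a - c ^ 2 ∈ maximalIdeal (Localization.AtPrime p) := by
    rw [← IsLocalRing.residue_eq_zero_iff, map_sub, map_pow, hc, hcbar, sub_self]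
  have hφac : algebraMap _ (Localization.AtPrime P) (a - c ^ 2) ∈ maximalIdeal (Localization.AtPrime P) :=
    map_nonunit _ _ hac
  have hzm : z ∈ maximalIdeal (Localization.AtPrime P) := by
    refine (Ideal.map_le_iff_le_comap.mpr fun π hπ => ?_) hz
    rw [Ideal.mem_comap, IsScalarTower.algebraMap_apply A B (Localization.AtPrime P)]
    have hπP : algebraMap A B π ∈ P := by
      have hover : p = P.under A := Ideal.LiesOver.over
      rw [hover] at hπ
      exact Ideal.mem_comap.mp hπ
    exact (IsLocalization.AtPrime.to_map_mem_maximal_iff (Localization.AtPrime P) P _).mpr hπP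
  have hsq : (b - algebraMap _ (Localization.AtPrime P) c) ^ 2 ∈ maximalIdeal (Localization.AtPrime P) := by
    have hid : (b - algebraMap _ (Localization.AtPrime P) c) ^ 2 =
        (y + z) + algebraMap _ (Localization.AtPrime P) (a - c ^ 2) := by
      rw [hyz, map_sub, map_pow]
      have : (2 : Localization.AtPrime P) * (algebraMap _ (Localization.AtPrime P) c *
          (algebraMap _ (Localization.AtPrime P) c - b)) = 0 := by rw [h2B, zero_mul]
      linear_combination this
    rw [hid]
    exact Ideal.add_mem _ (Ideal.add_mem _ (Ideal.pow_le_self two_ne_zero hy) hzm) hφac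
  exact Ideal.IsPrime.mem_of_pow_mem inferInstance 2 hsq

end SquareClosed

end Summit.ResolutionOfSingularities.ResolutionOfSingularities.Theorems.SwitchingDichotomy.K7HatFibreSquares

end
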